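import Summits.HodgeConjecture.HodgeCM.Literature.QuadraticCharacter_1

/-! PORT of `HodgeCM/Literature/QuadraticCharacter.lean` (HodgeCMPerL run 82) — part 2: continuation of `Summits.HodgeConjecture.HodgeCM.Literature.QuadraticCharacter_1` (split at a top-level declaration boundary by port_pkg.py; scope re-opened below; declarations unchanged). -/

-- port_pkg: scope re-opened for this part (file-level context, then the namespace/section stack open at the cut)
set_option autoImplicit false
noncomputable section
open NumberField InfinitePlace NumberField.InfinitePlace.Completion IsDedekindDomain
open Literature.NumberTheory.QuadraticForms
namespace NumberField
variable (K : Type) [Field K] [NumberField K]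
variable {K}
variable {a : K} (ha : ¬ IsSquare a)
section RealPlace
variable (K)
/-- **`(c)_v ∈ K^× N_{K(√a)/K} J ↔ c > 0`** at a real place `v` with `σ_v(a) < 0`.  "If": a positive
real is a square, hence a local norm.  "Only if": writing `(c)_v = (β)·n` with `n` a norm idèle,
`γ = β⁻¹` is a local norm from `K_u(√a)` at every place `u ≠ v`, and `γ·c` is one at `v`; were `c < 0`,
then `σ_v(γ) < 0` and the Hilbert symbols `(γ, a)_u` would be `-1` at `v` alone — an odd number of
places, contradicting Hilbert's reciprocity law (O'Meara 71:18, the vendored kernel theorem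
`hilbertReciprocity_holds`). -/
theorem single_mem_quadraticNormGroup_iff {a : K} (ha0 : a ≠ 0) {v : InfinitePlace K} (hv : v.IsReal)
    (hav : embedding_of_isReal hv a < 0) (c : (v.Completion)ˣ) :
    infUnitsToIdele K (InfiniteAdeleRing.singleUnits K v c) ∈ quadraticNormGroup K a ↔
      0 < ringEquivRealOfIsReal hv (c : v.Completion) := by
  classical
  constructor
  · intro hmem
    have hc0 : ringEquivRealOfIsReal hv (c : v.Completion) ≠ 0 :=
      (map_ne_zero_iff _ (ringEquivRealOfIsReal hv).injective).2 c.ne_zero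
    by_contra hle
    have hneg : ringEquivRealOfIsReal hv (c : v.Completion) < 0 := lt_of_le_of_ne (not_lt.1 hle) hc0
    obtain ⟨p, hp, n, hn, hpn⟩ := Subgroup.mem_sup.1 hmem
    obtain ⟨β, rfl⟩ := hp
    have hγ0 : ((β⁻¹ : Kˣ) : K) ≠ 0 := (β⁻¹).ne_zero
    have hn_eq : n = Units.map (algebraMap K (AdeleRing (𝓞 K) K) : K →* AdeleRing (𝓞 K) K) β⁻¹ *
        infUnitsToIdele K (InfiniteAdeleRing.singleUnits K v c) := by
      rw [map_inv, ← hpn, inv_mul_cancel_left]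
    have hN := mem_normIdeles_iff.1 hn
    -- the components of the norm idèle `n = (β⁻¹)·(c)_v`
    have hnu : ∀ u : HeightOneSpectrum (𝓞 K),
        (ideleFiniteComponent K u n : u.adicCompletion K) = algebraMap K _ ((β⁻¹ : Kˣ) : K) := fun u => by
      rw [hn_eq, map_mul, ideleFiniteComponent_infUnitsToIdele, mul_one, ideleFiniteComponent_principal,
        val_unitsMap_algebraMap]
    have hnw : ∀ w : InfinitePlace K, w ≠ v →
        (ideleInfiniteComponent K w n : w.Completion) = algebraMap K _ ((β⁻¹ : Kˣ) : K) := fun w hw => by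
      rw [hn_eq, map_mul, ideleInfiniteComponent_single_of_ne K c hw, mul_one, ideleInfiniteComponent_principal,
        val_unitsMap_algebraMap]
    have hnv : (ideleInfiniteComponent K v n : v.Completion) = algebraMap K _ ((β⁻¹ : Kˣ) : K) * c := by
      rw [hn_eq, map_mul, Units.val_mul, ideleInfiniteComponent_principal, val_unitsMap_algebraMap,
        val_ideleInfiniteComponent_single_self]
    -- finite places: `β⁻¹` is a local norm, `(β⁻¹, a)_u = 1`
    have hfin : ∀ u : HeightOneSpectrum (𝓞 K),
        hilbertSymbol (u.adicCompletion K) (algebraMap K _ ((β⁻¹ : Kˣ) : K)) (algebraMap K _ a) = 1 := by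
      intro u
      haveI : CharZero (u.adicCompletion K) := charZero_of_injective_algebraMap (algebraMap K _).injective
      have h2 := (hilbertSymbol_eq_one_iff_mem_quadraticNormSubgroup (F := u.adicCompletion K)
        ((map_ne_zero (algebraMap K (u.adicCompletion K))).2 ha0) (ideleFiniteComponent K u n)).2 (hN.1 u)
      rwa [hnu u] at h2
    -- infinite places `w ≠ v`: the same
    have hinf : ∀ w : InfinitePlace K, w ≠ v →
        hilbertSymbol w.Completion (algebraMap K _ ((β⁻¹ : Kˣ) : K)) (algebraMap K _ a) = 1 := by
      intro w hw
      haveI : CharZero w.Completion := charZero_of_injective_algebraMap (algebraMap K _).injective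
      have h2 := (hilbertSymbol_eq_one_iff_mem_quadraticNormSubgroup (F := w.Completion)
        ((map_ne_zero (algebraMap K w.Completion)).2 ha0) (ideleInfiniteComponent K w n)).2 (hN.2 w)
      rwa [hnw w hw] at h2
    -- at `v`: `β⁻¹ c` is a local norm with `c < 0`, so `σ_v(β⁻¹) < 0` and `(β⁻¹, a)_v = -1`
    have hγv : embedding_of_isReal hv ((β⁻¹ : Kˣ) : K) < 0 := by
      haveI : CharZero v.Completion := charZero_of_injective_algebraMap (algebraMap K _).injective
      have h1 := (hilbertSymbol_eq_one_iff_mem_quadraticNormSubgroup (F := v.Completion)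
        ((map_ne_zero (algebraMap K v.Completion)).2 ha0) (ideleInfiniteComponent K v n)).2 (hN.2 v)
      rw [hnv, ← hilbertSymbol_map_ringEquiv (ringEquivRealOfIsReal hv), map_mul, ringEquivRealOfIsReal_algebraMap,
        ringEquivRealOfIsReal_algebraMap, Real.hilbertSymbol_eq_one_iff] at h1
      rcases h1 with h1 | h1
      · rcases pos_and_pos_or_neg_and_neg_of_mul_pos h1 with ⟨-, h2⟩ | ⟨h2, -⟩
        · exact absurd h2 (not_lt.2 hneg.le)
        · exact h2
      · exact absurd h1 (not_lt.2 hav.le)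
    have hv1 : hilbertSymbol v.Completion (algebraMap K _ ((β⁻¹ : Kˣ) : K)) (algebraMap K _ a) = -1 :=
      (hilbertSymbol_completion_eq_neg_one_iff_of_isReal hv _ a).2 ⟨hγv.le, hav.le⟩
    -- Hilbert reciprocity: the number of places with symbol `-1` is even — but here it is `1`
    obtain ⟨-, heven⟩ := hilbertReciprocity_holds K ((β⁻¹ : Kˣ) : K) a hγ0 ha0
    have hSfin : {u : HeightOneSpectrum (𝓞 K) | hilbertSymbol (u.adicCompletion K)
        (algebraMap K _ ((β⁻¹ : Kˣ) : K)) (algebraMap K _ a) = -1} = ∅ := by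
      refine Set.eq_empty_iff_forall_notMem.2 fun u hu => ?_
      rw [Set.mem_setOf_eq, hfin u] at hu
      norm_num at hu
    have hSinf : {w : InfinitePlace K | hilbertSymbol w.Completion
        (algebraMap K _ ((β⁻¹ : Kˣ) : K)) (algebraMap K _ a) = -1} = {v} := by
      ext w
      simp only [Set.mem_setOf_eq, Set.mem_singleton_iff]
      refine ⟨fun hw => ?_, fun hw => hw ▸ hv1⟩
      by_contra hne
      rw [hinf w hne] at hw
      norm_num at hw
    rw [hSfin, hSinf, Set.ncard_empty, Set.ncard_singleton, zero_add] at heven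
    exact Nat.not_even_one heven
  · intro hc
    refine normIdeles_le_quadraticNormGroup K a (mem_normIdeles_iff.2 ⟨fun u => ?_, fun w => ?_⟩)
    · rw [ideleFiniteComponent_infUnitsToIdele]
      exact Subgroup.one_mem _
    · by_cases hw : w = v
      · subst hw
        refine mem_quadraticNormSubgroup_of_isSquare _ ?_
        rw [val_ideleInfiniteComponent_single_self]
        exact isSquare_completion_of_pos hv hc
      · rw [ideleInfiniteComponent_single_of_ne K c hw]
        exact Subgroup.one_mem _

variable {K}

/-- **`ε_v(c) = sgn(c)`** at a real place `v` with `σ_v(a) < 0`: the quadratic character of the class of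
the idèle `(c)_v` is `1` if `c > 0` and `-1` if `c < 0`. -/
theorem quadraticCharacter_single_of_isReal {v : InfinitePlace K} (hv : v.IsReal)
    (hav : embedding_of_isReal hv a < 0) (c : (v.Completion)ˣ) :
    quadraticCharacter ha (infUnitsToClass K (InfiniteAdeleRing.singleUnits K v c)) =
      if 0 < ringEquivRealOfIsReal hv (c : v.Completion) then 1 else -1 := by
  have ha0 : a ≠ 0 := fun h => ha (h ▸ IsSquare.zero)
  have hmk : infUnitsToClass K (InfiniteAdeleRing.singleUnits K v c) =
      (QuotientGroup.mk (infUnitsToIdele K (InfiniteAdeleRing.singleUnits K v c)) : IdeleClassGroup K) := rfl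
  rw [hmk, quadraticCharacter_mk]
  split_ifs with hc
  · exact (quadraticCharacterIdele_eq_one_iff ha _).2 ((single_mem_quadraticNormGroup_iff K ha0 hv hav c).2 hc)
  · exact quadraticCharacterIdele_apply_of_not_mem ha
      (fun h => hc ((single_mem_quadraticNormGroup_iff K ha0 hv hav c).1 h))

end RealPlace


/-! ## The archimedean type of `ε`: `sgn` at every real place (K totally real, `a` totally negative) -/

section ArchimedeanType

/-- `x/|x|` on `ℝˣ ⊂ ℂˣ` is the sign. -/
theorem _root_.Complex.unitPart_ofRealUnits_eq_ite (r : ℝˣ) :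
    Complex.unitPart (Complex.ofRealUnits r) = if 0 < (r : ℝ) then 1 else -1 := by
  split_ifs with hr
  · exact Complex.unitPart_ofRealUnits_of_pos r hr
  · exact Circle.ext (by
      rw [Complex.coe_unitPart_ofRealUnits_of_neg r (lt_of_le_of_ne (not_lt.1 hr) r.ne_zero),
        Circle.coe_neg, Circle.coe_one])

variable (K)

omit [NumberField K] in
/-- The `v`-coordinate `y_v ∈ K_vˣ` of an infinite idèle. -/
def infCoord (v : InfinitePlace K) : (InfiniteAdeleRing K)ˣ →* (v.Completion)ˣ :=
  Units.map (InfiniteAdeleRing.evalRingHom K v).toMonoidHom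

omit [NumberField K] in
/-- (Ported verbatim from the HodgeCMPerL package; no docstring in the source.) -/
@[simp] theorem val_infCoord (v : InfinitePlace K) (y : (InfiniteAdeleRing K)ˣ) :
    (infCoord K v y : v.Completion) = (y : InfiniteAdeleRing K) v := rfl

/-- **`y = ∏_v (y_v)_v`**: an infinite idèle is the product of its one-place pieces. -/
theorem prod_singleUnits_infCoord (y : (InfiniteAdeleRing K)ˣ) :
    ∏ v : InfinitePlace K, InfiniteAdeleRing.singleUnits K v (infCoord K v y) = y := by
  classical
  refine Units.ext (funext fun w => ?_)
  show InfiniteAdeleRing.evalRingHom K w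
      ((∏ v : InfinitePlace K, InfiniteAdeleRing.singleUnits K v (infCoord K v y) :
        (InfiniteAdeleRing K)ˣ) : InfiniteAdeleRing K) = InfiniteAdeleRing.evalRingHom K w (y : InfiniteAdeleRing K)
  rw [Units.coe_prod, map_prod,
    Finset.prod_eq_single w (fun v _ hvw => ?_) (fun h => absurd (Finset.mem_univ w) h)]
  · rw [InfiniteAdeleRing.evalRingHom_apply, InfiniteAdeleRing.singleUnits_apply_self, val_infCoord]
    rfl
  · rw [InfiniteAdeleRing.evalRingHom_apply]
    exact InfiniteAdeleRing.singleUnits_apply_of_ne K v _ (Ne.symm hvw)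

variable {K}

/-- **`ε` has archimedean type `(1, …, 1)`**: for `K` totally real and `a` negative at every real
place, `ε(y)^m = ∏_v (y_v/|y_v|)^m` for every infinite idèle `y` and every integer `m` — the
hypothesis `hχ` of `exists_unitaryHeckeCharacter_of_isCMField_parity` (`ClassBaseChangeParity`) for
`χA = ε^m`.  (PerL v5 l. 307: "`ε_{L/L₀}` … the two prescriptions agree on `L^×_{0,∞}`".) -/
theorem quadraticCharacter_infUnitsToClass_zpow (hK : ∀ v : InfinitePlace K, v.IsReal)
    (hav : ∀ (v : InfinitePlace K) (hv : v.IsReal), embedding_of_isReal hv a < 0) (m : ℤ)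
    (y : (InfiniteAdeleRing K)ˣ) :
    quadraticCharacter ha (infUnitsToClass K y) ^ m = infinityTypeChar K (fun _ => m) y := by
  conv_lhs => rw [← prod_singleUnits_infCoord K y]
  rw [map_prod, map_prod, ← Finset.prod_zpow, infinityTypeChar_apply]
  refine Finset.prod_congr rfl fun v _ => ?_
  rw [quadraticCharacter_single_of_isReal ha (hK v) (hav v (hK v)),
    ClassBaseChange.infLocalUnits_eq_ofRealUnits K hK y v, Complex.unitPart_ofRealUnits_eq_ite]
  rfl

/-- The same with `m = 1`: `ε(y) = ∏_v y_v/|y_v|` (`= ∏_v sgn y_v`). -/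
theorem quadraticCharacter_infUnitsToClass (hK : ∀ v : InfinitePlace K, v.IsReal)
    (hav : ∀ (v : InfinitePlace K) (hv : v.IsReal), embedding_of_isReal hv a < 0)
    (y : (InfiniteAdeleRing K)ˣ) :
    quadraticCharacter ha (infUnitsToClass K y) = infinityTypeChar K (fun _ => 1) y := by
  rw [← quadraticCharacter_infUnitsToClass_zpow ha hK hav 1 y, zpow_one]

end ArchimedeanType


/-! ## Independence of the generator: `ε` depends only on the extension `K(√a)` -/

section Canonical

omit [NumberField K] in
/-- `X² - (a b²) Y²` and `X² - a Y²` take the same non-zero values (`b ≠ 0`). -/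
theorem quadraticNormSubgroup_mul_sq {F : Type*} [Field F] (a : F) {b : F} (hb : b ≠ 0) :
    quadraticNormSubgroup F (a * b ^ 2) = quadraticNormSubgroup F a := by
  ext t
  simp only [mem_quadraticNormSubgroup_iff]
  constructor
  · rintro ⟨x, y, h⟩
    exact ⟨x, b * y, by rw [← h]; ring⟩
  · rintro ⟨x, y, h⟩
    exact ⟨x, y / b, by rw [← h]; field_simp⟩

variable (K)

/-- The norm idèles of `K(√(a b²)) = K(√a)` are those of `K(√a)`. -/
theorem normIdeles_mul_sq (a : K) {b : K} (hb : b ≠ 0) : normIdeles K (a * b ^ 2) = normIdeles K a := by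
  ext i
  rw [mem_normIdeles_iff, mem_normIdeles_iff]
  have hf : ∀ v : HeightOneSpectrum (𝓞 K),
      quadraticNormSubgroup (v.adicCompletion K) (algebraMap K _ (a * b ^ 2)) =
        quadraticNormSubgroup (v.adicCompletion K) (algebraMap K _ a) := fun v => by
    rw [map_mul, map_pow]
    exact quadraticNormSubgroup_mul_sq _ ((map_ne_zero (algebraMap K (v.adicCompletion K))).2 hb)
  have hi : ∀ w : InfinitePlace K,
      quadraticNormSubgroup w.Completion (algebraMap K _ (a * b ^ 2)) =
        quadraticNormSubgroup w.Completion (algebraMap K _ a) := fun w => by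
    rw [map_mul, map_pow]
    exact quadraticNormSubgroup_mul_sq _ ((map_ne_zero (algebraMap K w.Completion)).2 hb)
  simp only [hf, hi]

/-- (Ported verbatim from the HodgeCMPerL package; no docstring in the source.) -/
theorem quadraticNormGroup_mul_sq (a : K) {b : K} (hb : b ≠ 0) :
    quadraticNormGroup K (a * b ^ 2) = quadraticNormGroup K a := by
  rw [quadraticNormGroup, quadraticNormGroup, normIdeles_mul_sq K a hb]

variable {K}

/-- Equal norm groups give equal characters. -/
theorem quadraticCharacterIdele_congr {a a' : K} (ha : ¬ IsSquare a) (ha' : ¬ IsSquare a')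
    (h : quadraticNormGroup K a = quadraticNormGroup K a') :
    quadraticCharacterIdele a ha = quadraticCharacterIdele a' ha' := by
  refine MonoidHom.ext fun x => ?_
  by_cases hx : x ∈ quadraticNormGroup K a
  · rw [(quadraticCharacterIdele_eq_one_iff ha x).2 hx, (quadraticCharacterIdele_eq_one_iff ha' x).2 (h ▸ hx)]
  · rw [quadraticCharacterIdele_apply_of_not_mem ha hx, quadraticCharacterIdele_apply_of_not_mem ha' (h ▸ hx)]

/-- **`ε_{K(√a)/K}` depends only on the square class of `a`**: `ε_{a b²} = ε_a`. -/
theorem quadraticCharacter_eq_of_eq_mul_sq {a a' : K} (ha : ¬ IsSquare a) (ha' : ¬ IsSquare a') {b : K}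
    (hb : b ≠ 0) (h : a' = a * b ^ 2) : quadraticCharacter ha' = quadraticCharacter ha := by
  refine MonoidHom.ext fun c => ?_
  induction c using QuotientGroup.induction_on with
  | H x =>
    rw [quadraticCharacter_mk, quadraticCharacter_mk,
      quadraticCharacterIdele_congr ha' ha (by rw [h, quadraticNormGroup_mul_sq K a hb])]

end Canonical

end NumberField

end
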